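import Literature.NumberTheory.LFunctions.WeilMarkovQuadratic
import Literature.NumberTheory.LFunctions.WeilGroundState
import Literature.NumberTheory.LFunctions.WeilGroundStateRealZerosProofs
import Literature.NumberTheory.LFunctions.WeilWindowSuzukiProofs
import Literature.NumberTheory.LFunctions.WeilSemilocalCompactnessProofs

/-!
# Stub `stub_groundStateEnergy` of line `cut-dont-squeeze` for crux `WeilWindowFlow.WindowLipschitz`
(item stmt-RiemannHypothesis-1039, route route-RiemannHypothesis-WeilWindowFlow; registered skeleton rev 4,
`Summits/RiemannHypothesis/RiemannHypothesis/Cruxes/WindowLipschitz/Lines/cut-dont-squeeze.lean`)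

## What is proved

`stub_groundStateEnergy`: a ground state `u` of Weil's quadratic form on the window `[-a, a]`
(`IsWeilGroundState a u`: an `L²`-limit of an `L²`-normalised minimising sequence `gₙ` of window
test functions) has FINITE archimedean energy, `t ↦ ρ(t) D_t(u)` is integrable on `(0, ∞)`
(`ρ = weilArchDensity`, `D_t = weilIncrement`), and sits at the bottom of the closed form:

  `P(u) + 𝓔_a(u) ≤ (M_a + ε(a)) · ∫ |u|²`

(`P = weilPoleForm`, `𝓔_a = weilDirichletEnergy a`, `M_a = weilMarkovConstant a`,
`ε(a) = weilGroundEnergy a`; and `∫ |u|² = 1`). This is the lower semicontinuity of the energy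
along the defining sequence (Bombieri 2000, §4, proof of Thm 3: `T[f * f̄*] ≤ lim T[f_ν * f̄_ν*]`).

## Proof

1. For every jump length `t`, `D_t(gₙ) → D_t(u)`: the increment map `f ↦ f(· + t) − f` is
   `2`-Lipschitz in `L²` (Minkowski and translation invariance of Lebesgue measure).
2. `P(gₙ) → P(u)`: the pairings `∫ gₙ w`, `w = cosh(·/2), sinh(·/2)`, only see `w` on the window,
   where it is square integrable, and `L²`-pairings with a fixed `L²` function are continuous.
3. By the Markov decomposition `Re Q(gₙ) = P(gₙ) + 𝓔_a(gₙ) − M_a` and `Re Q(gₙ) → ε(a)`,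
   `𝓔_a(gₙ) → ε(a) − P(u) + M_a`; the prime part (a finite sum of increments) converges by 1, so the
   archimedean parts `Aₙ = ∫₀^∞ ρ D(gₙ)` converge to `ε(a) − P(u) + M_a − primes(u)`.
4. Fatou in the jump length (`lintegral_liminf_le` on `ENNReal.ofReal (ρ D(gₙ))`, pointwise limit
   `ρ D(u)`, which is therefore measurable): `∫₀^∞ ρ D(u) ≤ lim Aₙ < ∞`.
5. Assemble.

## References

* E. Bombieri, *Remarks on Weil's quadratic functional in the theory of prime numbers I*, Rend.
  Mat. Acc. Lincei (9) 11 (2000), 183–233, §4 Theorem 3 (proof).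
-/

set_option linter.dupNamespace false

noncomputable section

open MeasureTheory Set Filter
open scoped Topology ENNReal NNReal ComplexConjugate ArithmeticFunction.vonMangoldt

namespace Summit.RiemannHypothesis.RiemannHypothesis.Theorems.WeilWindowFlowWindowLipschitz

open Literature.NumberTheory.LFunctions
open Literature.NumberTheory.LFunctions.ConnesVanSuijlekom

/-! ## Step 1: increments converge along `L²`-convergent sequences -/

/-- The increment map `f ↦ (x ↦ f(x + t) − f(x))` is `2`-Lipschitz in `L²`:
`∫ |(f(x+t) − f x) − (h(x+t) − h x)|² ≤ 4 ∫ |f − h|²` (Minkowski and translation invariance). -/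
private theorem integral_norm_sq_increment_sub_le {f h : ℝ → ℂ} (hf : MemLp f 2) (hh : MemLp h 2)
    (t : ℝ) :
    ∫ x, ‖(f (x + t) - f x) - (h (x + t) - h x)‖ ^ 2 ≤ 4 * ∫ x, ‖f x - h x‖ ^ 2 := by
  have hd : MemLp (fun x ↦ f x - h x) 2 := hf.sub hh
  have hdt : MemLp (fun x ↦ f (x + t) - h (x + t)) 2 :=
    hd.comp_measurePreserving (measurePreserving_add_right volume t)
  have hM := sqrt_integral_norm_sq_sub_le hdt hd
  have htr : ∫ x, ‖f (x + t) - h (x + t)‖ ^ 2 = ∫ x, ‖f x - h x‖ ^ 2 :=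
    integral_add_right_eq_self (fun x ↦ ‖f x - h x‖ ^ 2) t
  rw [htr] at hM
  have he : ∀ x, (f (x + t) - f x) - (h (x + t) - h x) = (f (x + t) - h (x + t)) - (f x - h x) :=
    fun x ↦ by ring
  simp_rw [he]
  have hA : 0 ≤ ∫ x, ‖(f (x + t) - h (x + t)) - (f x - h x)‖ ^ 2 :=
    integral_nonneg fun _ ↦ by positivity
  have hB : 0 ≤ ∫ x, ‖f x - h x‖ ^ 2 := integral_nonneg fun _ ↦ by positivity
  calc ∫ x, ‖(f (x + t) - h (x + t)) - (f x - h x)‖ ^ 2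
      = (√(∫ x, ‖(f (x + t) - h (x + t)) - (f x - h x)‖ ^ 2)) ^ 2 := (Real.sq_sqrt hA).symm
    _ ≤ (√(∫ x, ‖f x - h x‖ ^ 2) + √(∫ x, ‖f x - h x‖ ^ 2)) ^ 2 :=
        pow_le_pow_left₀ (Real.sqrt_nonneg _) hM 2
    _ = 4 * (√(∫ x, ‖f x - h x‖ ^ 2)) ^ 2 := by ring
    _ = 4 * ∫ x, ‖f x - h x‖ ^ 2 := by rw [Real.sq_sqrt hB]

/-- **Increments converge along `L²`-convergent sequences**: if `gₙ → u` in `L²` then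
`D_t(gₙ) → D_t(u)` for every jump length `t`. -/
private theorem tendsto_weilIncrement {u : ℝ → ℂ} {g : ℕ → ℝ → ℂ} (hu : MemLp u 2)
    (hgm : ∀ n, MemLp (g n) 2) (hL2 : Tendsto (fun n ↦ ∫ x, ‖g n x - u x‖ ^ 2) atTop (𝓝 0))
    (t : ℝ) : Tendsto (fun n ↦ weilIncrement (g n) t) atTop (𝓝 (weilIncrement u t)) := by
  have hU : MemLp (fun x ↦ u (x + t) - u x) 2 :=
    (hu.comp_measurePreserving (measurePreserving_add_right volume t)).sub hu
  have hG : ∀ n, MemLp (fun x ↦ g n (x + t) - g n x) 2 := fun n ↦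
    ((hgm n).comp_measurePreserving (measurePreserving_add_right volume t)).sub (hgm n)
  have hlim : Tendsto (fun n ↦ ∫ x, ‖(g n (x + t) - g n x) - (u (x + t) - u x)‖ ^ 2)
      atTop (𝓝 0) := by
    refine squeeze_zero (fun n ↦ integral_nonneg fun _ ↦ by positivity)
      (fun n ↦ integral_norm_sq_increment_sub_le (hgm n) hu t) ?_
    simpa using hL2.const_mul 4
  unfold weilIncrement
  exact tendsto_integral_norm_sq hU hG hlim

/-! ## Step 2: the pole form converges -/

/-- Pairings with a fixed continuous weight converge along the defining sequence of a ground
state: `∫ gₙ w → ∫ u w` (everything lives on the window, where `w` is square integrable, and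
`L²`-pairings with a fixed `L²` function are continuous). -/
private theorem tendsto_integral_mul_of_continuous {a : ℝ} {u : ℝ → ℂ} {g : ℕ → ℝ → ℂ}
    (h : IsWeilGroundState a u) (hg : ∀ n, IsWeilTest (g n) ∧ tsupport (g n) ⊆ Icc (-a) a)
    (hL2 : Tendsto (fun n ↦ ∫ x, ‖g n x - u x‖ ^ 2) atTop (𝓝 0)) {w : ℝ → ℂ}
    (hw : Continuous w) :
    Tendsto (fun n ↦ ∫ x, g n x * w x) atTop (𝓝 (∫ x, u x * w x)) := by
  set W : ℝ → ℂ := (Icc (-a) a).indicator w with hW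
  -- `W ∈ L²`
  have hWm : MemLp W 2 := by
    rw [hW, memLp_indicator_iff_restrict measurableSet_Icc]
    obtain ⟨C, hC⟩ := isCompact_Icc.exists_bound_of_continuousOn hw.continuousOn
    exact MemLp.of_bound hw.aestronglyMeasurable C
      ((ae_restrict_iff' measurableSet_Icc).2 (Eventually.of_forall hC))
  have hWc : MemLp (fun x ↦ conj (W x)) 2 := memLp_conj hWm
  have hgm : ∀ n, MemLp (g n) 2 := fun n ↦ (hg n).1.memLp_two
  have key := tendsto_integral_mul_conj_left hWc h.memLp hgm hL2
  simp only [Complex.conj_conj] at key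
  -- replace `W` by `w` in the pairings
  have hgW : ∀ n, ∫ x, g n x * W x = ∫ x, g n x * w x := fun n ↦ by
    refine integral_congr_ae (Eventually.of_forall fun x ↦ ?_)
    by_cases hx : x ∈ Icc (-a) a
    · simp [hW, hx]
    · have h0 : g n x = 0 := image_eq_zero_of_notMem_tsupport fun h' ↦ hx ((hg n).2 h')
      simp [h0]
  have huW : ∫ x, u x * W x = ∫ x, u x * w x := by
    refine integral_congr_ae ?_
    filter_upwards [h.ae_eq_zero_of_notMem] with x hx
    by_cases hxK : x ∈ Icc (-a) a
    · simp [hW, hxK]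
    · simp [hx hxK]
  simpa only [hgW, huW] using key

/-- **The pole form converges** along the defining sequence of a ground state: `P(gₙ) → P(u)`. -/
private theorem tendsto_weilPoleForm {a : ℝ} {u : ℝ → ℂ} {g : ℕ → ℝ → ℂ}
    (h : IsWeilGroundState a u) (hg : ∀ n, IsWeilTest (g n) ∧ tsupport (g n) ⊆ Icc (-a) a)
    (hL2 : Tendsto (fun n ↦ ∫ x, ‖g n x - u x‖ ^ 2) atTop (𝓝 0)) :
    Tendsto (fun n ↦ weilPoleForm (g n)) atTop (𝓝 (weilPoleForm u)) := by
  unfold weilPoleForm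
  have hc := tendsto_integral_mul_of_continuous h hg hL2
    (w := fun t : ℝ ↦ (Real.cosh (t / 2) : ℂ)) (by fun_prop)
  have hs := tendsto_integral_mul_of_continuous h hg hL2
    (w := fun t : ℝ ↦ (Real.sinh (t / 2) : ℂ)) (by fun_prop)
  exact ((hc.norm.pow 2).const_mul 2).sub ((hs.norm.pow 2).const_mul 2)

/-! ## Step 4: Fatou in the jump length -/

/-- The archimedean density is measurable. -/
private theorem measurable_weilArchDensity : Measurable weilArchDensity :=
  (by fun_prop : Continuous fun t : ℝ ↦ Real.exp (t / 2)).measurable.div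
    (by fun_prop : Continuous fun t : ℝ ↦ 2 * Real.sinh t).measurable

/-- **Fatou in the jump length.** If `D_t(gₙ) → D_t(u)` for every `t`, the `gₙ` are test
functions (so `t ↦ ρ(t) D_t(gₙ)` is continuous, non-negative and integrable on `(0, ∞)`) and the
archimedean energies `∫₀^∞ ρ D(gₙ)` converge to `L`, then `t ↦ ρ(t) D_t(u)` is integrable on
`(0, ∞)` with integral `≤ L`. -/
private theorem integrableOn_arch_of_tendsto {u : ℝ → ℂ} {g : ℕ → ℝ → ℂ}
    (hgt : ∀ n, IsWeilTest (g n))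
    (hD : ∀ t, Tendsto (fun n ↦ weilIncrement (g n) t) atTop (𝓝 (weilIncrement u t))) {L : ℝ}
    (hA : Tendsto (fun n ↦ ∫ t in Ioi (0 : ℝ), weilArchDensity t * weilIncrement (g n) t)
      atTop (𝓝 L)) :
    IntegrableOn (fun t ↦ weilArchDensity t * weilIncrement u t) (Ioi 0) ∧
      ∫ t in Ioi (0 : ℝ), weilArchDensity t * weilIncrement u t ≤ L := by
  have hFmeas : ∀ n, Measurable fun t ↦ weilArchDensity t * weilIncrement (g n) t := fun n ↦
    measurable_weilArchDensity.mul (continuous_weilIncrement (hgt n)).measurable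
  have hFlim : ∀ t, Tendsto (fun n ↦ weilArchDensity t * weilIncrement (g n) t) atTop
      (𝓝 (weilArchDensity t * weilIncrement u t)) := fun t ↦ (hD t).const_mul _
  have hFu_meas : AEStronglyMeasurable (fun t ↦ weilArchDensity t * weilIncrement u t)
      (volume.restrict (Ioi 0)) :=
    aestronglyMeasurable_of_tendsto_ae atTop (fun n ↦ (hFmeas n).aestronglyMeasurable)
      (Eventually.of_forall hFlim)
  have hF_nonneg : ∀ f : ℝ → ℂ,
      0 ≤ᵐ[volume.restrict (Ioi 0)] fun t ↦ weilArchDensity t * weilIncrement f t := fun f ↦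
    (ae_restrict_iff' measurableSet_Ioi).2 (Eventually.of_forall fun t ht ↦
      mul_nonneg (weilArchDensity_pos ht).le (weilIncrement_nonneg f t))
  have hFint : ∀ n, IntegrableOn (fun t ↦ weilArchDensity t * weilIncrement (g n) t) (Ioi 0) :=
    fun n ↦ integrableOn_weilArchDensity_mul_weilIncrement (hgt n)
  have hL : 0 ≤ L := ge_of_tendsto' hA fun n ↦ setIntegral_nonneg measurableSet_Ioi
    fun t ht ↦ mul_nonneg (weilArchDensity_pos ht).le (weilIncrement_nonneg _ t)
  -- Fatou
  have hlint : ∫⁻ t in Ioi (0 : ℝ), ENNReal.ofReal (weilArchDensity t * weilIncrement u t) ≤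
      ENNReal.ofReal L := by
    have h1 : ∀ t, liminf (fun n ↦ ENNReal.ofReal (weilArchDensity t * weilIncrement (g n) t))
        atTop = ENNReal.ofReal (weilArchDensity t * weilIncrement u t) := fun t ↦
      (ENNReal.tendsto_ofReal (hFlim t)).liminf_eq
    have h2 : Tendsto (fun n ↦ ∫⁻ t in Ioi (0 : ℝ),
        ENNReal.ofReal (weilArchDensity t * weilIncrement (g n) t)) atTop
        (𝓝 (ENNReal.ofReal L)) := by
      have h3 : ∀ n, ∫⁻ t in Ioi (0 : ℝ), ENNReal.ofReal (weilArchDensity t * weilIncrement (g n) t)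
          = ENNReal.ofReal (∫ t in Ioi (0 : ℝ), weilArchDensity t * weilIncrement (g n) t) :=
        fun n ↦ (ofReal_integral_eq_lintegral_ofReal (hFint n) (hF_nonneg (g n))).symm
      simp only [h3]
      exact ENNReal.tendsto_ofReal hA
    calc ∫⁻ t in Ioi (0 : ℝ), ENNReal.ofReal (weilArchDensity t * weilIncrement u t)
        = ∫⁻ t in Ioi (0 : ℝ), liminf (fun n ↦
            ENNReal.ofReal (weilArchDensity t * weilIncrement (g n) t)) atTop := by
          simp only [h1]
      _ ≤ liminf (fun n ↦ ∫⁻ t in Ioi (0 : ℝ),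
            ENNReal.ofReal (weilArchDensity t * weilIncrement (g n) t)) atTop :=
          lintegral_liminf_le fun n ↦ (hFmeas n).ennreal_ofReal
      _ = ENNReal.ofReal L := h2.liminf_eq
  have hint : IntegrableOn (fun t ↦ weilArchDensity t * weilIncrement u t) (Ioi 0) :=
    ⟨hFu_meas, (hasFiniteIntegral_iff_ofReal (hF_nonneg u)).2
      (hlint.trans_lt ENNReal.ofReal_lt_top)⟩
  refine ⟨hint, ?_⟩
  rw [integral_eq_lintegral_of_nonneg_ae (hF_nonneg u) hFu_meas]
  exact ENNReal.toReal_le_of_le_ofReal hL hlint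

/-! ## The stub -/

/-- **Finite energy and the bottom inequality for a ground state** (Bombieri 2000, §4, proof of
Thm 3, lower semicontinuity of the form along a minimising sequence). For a ground state `u` of
the window `[-a, a]` — an `L²`-limit of `L²`-normalised window test functions `gₙ` with
`Re Q(gₙ) → ε(a)` — the archimedean energy density `t ↦ ρ(t) D_t(u)` is integrable on `(0, ∞)`
and `P(u) + 𝓔_a(u) ≤ (M_a + ε(a)) ∫ |u|²`. Proof: `D_t(gₙ) → D_t(u)` for every `t` (Minkowski),
`P(gₙ) → P(u)` (`L²`-continuity of the pairings with `cosh(t/2)`, `sinh(t/2)` on the window), the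
Markov decomposition `Re Q(gₙ) = P(gₙ) + 𝓔_a(gₙ) − M_a` makes the archimedean energies of the `gₙ`
converge, and Fatou's lemma in the jump length bounds the archimedean energy of `u` by their
limit. -/
theorem stub_groundStateEnergy :
    ∀ (a : ℝ) (u : ℝ → ℂ), IsWeilGroundState a u →
      IntegrableOn (fun t ↦ weilArchDensity t * weilIncrement u t) (Ioi 0) ∧
        weilPoleForm u + weilDirichletEnergy a u ≤
          (weilMarkovConstant a + weilGroundEnergy a) * ∫ x, ‖u x‖ ^ 2 := by
  intro a u h
  obtain ⟨hu2, g, hg, hQ, hL2⟩ := id h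
  have hgm : ∀ n, MemLp (g n) 2 := fun n ↦ (hg n).1.memLp_two
  have hg' : ∀ n, IsWeilTest (g n) ∧ tsupport (g n) ⊆ Icc (-a) a := fun n ↦
    ⟨(hg n).1, (hg n).2.1⟩
  -- (1) increments converge, (2) the pole form converges
  have hD : ∀ t, Tendsto (fun n ↦ weilIncrement (g n) t) atTop (𝓝 (weilIncrement u t)) :=
    tendsto_weilIncrement hu2 hgm hL2
  have hP : Tendsto (fun n ↦ weilPoleForm (g n)) atTop (𝓝 (weilPoleForm u)) :=
    tendsto_weilPoleForm h hg' hL2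
  -- (3) the energies of the minimising sequence converge
  have hE : ∀ n, weilDirichletEnergy a (g n) =
      (weilQuadratic (g n)).re - weilPoleForm (g n) + weilMarkovConstant a := by
    intro n
    have := weilQuadratic_re_eq_weilPoleForm_add_weilDirichletEnergy_sub (hg n).1 (hg n).2.1
    rw [(hg n).2.2, mul_one] at this
    linarith
  have hElim : Tendsto (fun n ↦ weilDirichletEnergy a (g n)) atTop
      (𝓝 (weilGroundEnergy a - weilPoleForm u + weilMarkovConstant a)) := by
    simp only [hE]
    exact (hQ.sub hP).add tendsto_const_nhds
  -- the prime parts converge (finite sums of increments)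
  have hprimes : Tendsto (fun k ↦ ∑ n ∈ weilPrimeIndex a,
      (Λ n : ℝ) / Real.sqrt n * weilIncrement (g k) (Real.log n)) atTop
      (𝓝 (∑ n ∈ weilPrimeIndex a, (Λ n : ℝ) / Real.sqrt n * weilIncrement u (Real.log n))) :=
    tendsto_finsetSum _ fun n _ ↦ (hD (Real.log n)).const_mul _
  -- hence the archimedean parts converge
  have hA_eq : (fun k ↦ ∫ t in Ioi (0 : ℝ), weilArchDensity t * weilIncrement (g k) t) =
      fun k ↦ weilDirichletEnergy a (g k) - ∑ n ∈ weilPrimeIndex a,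
        (Λ n : ℝ) / Real.sqrt n * weilIncrement (g k) (Real.log n) := by
    funext k
    simp only [weilDirichletEnergy]
    ring
  have hA : Tendsto (fun k ↦ ∫ t in Ioi (0 : ℝ), weilArchDensity t * weilIncrement (g k) t)
      atTop (𝓝 (weilGroundEnergy a - weilPoleForm u + weilMarkovConstant a -
        ∑ n ∈ weilPrimeIndex a, (Λ n : ℝ) / Real.sqrt n * weilIncrement u (Real.log n))) := by
    rw [hA_eq]
    exact hElim.sub hprimes
  -- (4) Fatou in the jump length
  obtain ⟨hint, hle⟩ := integrableOn_arch_of_tendsto (fun n ↦ (hg n).1) hD hA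
  refine ⟨hint, ?_⟩
  -- (5) assemble
  rw [h.integral_norm_sq, mul_one]
  have hsplit : weilDirichletEnergy a u = (∑ n ∈ weilPrimeIndex a,
      (Λ n : ℝ) / Real.sqrt n * weilIncrement u (Real.log n)) +
        ∫ t in Ioi (0 : ℝ), weilArchDensity t * weilIncrement u t := rfl
  linarith

end Summit.RiemannHypothesis.RiemannHypothesis.Theorems.WeilWindowFlowWindowLipschitz

end
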